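import Literature.MathematicalPhysics.QuantumFieldTheory.Balaban1983to89.B9B8AveragedBondsStraight

/-!
# `Balaban1983to89.B9B8KnitLegsStraight` — THE [B8]-KNIT's COMPOSITE TRANSPORTERS `U(Γ^{(j)}_{y,x})` ARE CLOSE TO THE TAXICAB TRANSPORTERS of the
# fine field: `|U(Γ^{(j)}_{y,x}) − U(Γ^{taxi}_{Lʲy,x})| ≤ 8(d+1)²α₀(Lʲη)²` on the class (52) (file 5a2 of the coercivity transfer at the knit letter,
# junction J-B)

statement-level skeleton of published theorems with citation tags; proofs where landed; nothing here is a claim about the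
Yang–Mills mass gap

T. Bałaban, *Averaging operations for lattice gauge theories*, Commun. Math. Phys. **98** (1985) 17–51 [`Balaban1985Averaging`, "[B7]"]; T. Bałaban,
*Propagators for lattice gauge theories in a background field*, Commun. Math. Phys. **99** (1985) 389–434 [`Balaban1985BackgroundPropagators`, "[B9]"].

THE PRINT.  [B9] (3.19) p. 393: *«the parallel transport variables U(Γ^{(j)}_{y,x}) were defined by (52), (53) in [5]»*; (3.40) p. 397: *«Γ_{x,x′} … a shortest
contour connecting points x and x′»* (def-Y's taxicab transporters `parSY`); [B7] (52)–(53) p. 27, p. 25 (*«|V₀(Γ_{c,x}) − 1| < |Γ_{c,x}|dLα₀»*), (44) p. 24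
(plaquette smallness).  What is proved here is the cell's bookkeeping comparison of the two transporter conventions that the junction J-B must reconcile
(r06 map v1.2 §9(c): *«the adjoint∕transporter dictionary»*): the knit's hierarchical transporter and the straight taxicab one differ by `O(1)α₀(Lʲ/L^k)²` in
norm — an elementary consequence of file 5a (`avgIter_straight`) and of the plaquette bound, by re-ordering forward contours one transposition at a time.
It is NOT a numbered display of [B7]/[B9].

CITATION HEADER (lean-in-tree rule).  Cell `lit-balaban`, sub-row G-B9-LETTERS, junction J-B (lead RULINGS #3–#4) file 5a2 → seat `lit-balaban-p33` gen 91.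
REUSED BY NAME: file 5a (`scaleWord`, `hol_scaleWord_approx`, `avgIter_straight`, `norm_mul_sub_mul_le`), `B9B8AveragingKernelZd.compT`, `B8Eq119TwistedAxial.bgT`,
`B7Prop1Explicit` (`hol`, `treeWord`, `l1`, `U1`), `B7Prop2Explicit` (`pdev`, `le_pdev`), `B7Prop1Local.hol_plaqWord_eq`, Mathlib's `List.insertionSort`.

WHAT THIS FILE PROVES (sorry-free; definitions with bodies: `fw`, `treeDirs`, `knitDirs`).
* §1 FORWARD CONTOURS AS DIRECTION LISTS (`fw A`), their displacement = letter counts, ★ the TRANSPOSITION BOUND `‖V(…ab…) − V(…ba…)‖ ≤ pdev V`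
  (`norm_hol_fw_swap_le`), insertion (`norm_hol_fw_orderedInsert_le`), sorting (`norm_hol_fw_insertionSort_le`), and ★★ TWO FORWARD CONTOURS WITH THE SAME
  ENDPOINTS: `‖V(Γ) − V(Γ′)‖ ≤ 2|Γ|²·pdev V` (`norm_hol_fw_sub_le_of_disp_eq`).
* §2 THE KNIT's CONTOUR READ ON THE FINE LATTICE (`knitDirs L j x`: level by level, [B7]'s tree contour inside each `L`-block scaled by `Lᵐ`), its
  displacement `x − Lʲ·Bʲ(x)` and length `≤ D·Lʲ`, and ★★ `compT_straight`: `‖U(Γ^{(j)}_{y,x}) − V(fw (knitDirs L j x))‖ ≤ 6D²α₀(Lʲ/L^k)²` (file 5a per leg).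
* §3 ★★★ `compT_vs_fw`: for EVERY forward contour `Γ′` from `LʲBʲ(x)` to `x` (e.g. def-Y's taxicab one), `‖U(Γ^{(j)}_{y,x}) − V(Γ′)‖ ≤ 8D²α₀(Lʲ/L^k)²`
  on the class (52) (`j ≤ k`).

HONEST SCOPE.  Bookkeeping estimate with explicit constants under [B7]'s hypotheses; nothing of [B9] Thm 3.1 is proved or asserted; count-neutral; nothing
continuum, nothing about OS axioms or the mass gap.  No `sorry`, no `axiom`, no `instance`, no `notation`.  Seat `lit-balaban-p33` gen 91, 2026-08-28.
-/

noncomputable section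

namespace Literature.MathematicalPhysics.QuantumFieldTheory.Balaban1983to89.B9B8KnitLegsStraight

open B7Prop1Explicit renaming Site → LSite
open B7Prop1Explicit (e e_apply hol stepHol disp Letter seg treeWord l1 U1 mem_U1 hol_mem stepHol_mem hol_cons hol_nil hol_append disp_cons disp_nil disp_append
  stepHol_true seg_natCast length_treeWord disp_treeWord)
open B7Prop2Explicit (avgIter avgIter_mem AvgClosed pdev le_pdev pdev_nonneg C0 C0_pos c2')
open Literature.MathematicalPhysics.QuantumLattice (blockMap)
open B8Eq119TwistedAxial (bgT)
open B9B8AveragingKernelZd (compT compT_zero compT_succ)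
open B9B8AveragedBondsStraight (scaleWord scaleWord_cons scaleWord_nil scaleWord_append disp_scaleWord length_scaleWord hol_scaleWord_approx avgIter_straight
  norm_mul_sub_mul_le)

variable {D : ℕ} {𝔸 : Type} [NormedRing 𝔸] [NormOneClass 𝔸] [NormedAlgebra ℂ 𝔸] [CompleteSpace 𝔸]

/-! ## §1 Forward contours, transpositions, sorting -/

section Forward

/-- a FORWARD contour given by its list of directions. [cite: Balaban1985Averaging, (9) p.18, dictionary] -/
def fw (A : List (Fin D)) : List (Letter D) := A.map fun μ => (μ, true)

omit [NormedRing 𝔸] [NormOneClass 𝔸] [NormedAlgebra ℂ 𝔸] [CompleteSpace 𝔸] in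
/-- unfolding. [cite: Balaban1985Averaging, (9) p.18, bookkeeping] -/
@[simp] theorem fw_nil : fw ([] : List (Fin D)) = [] := rfl

omit [NormedRing 𝔸] [NormOneClass 𝔸] [NormedAlgebra ℂ 𝔸] [CompleteSpace 𝔸] in
/-- unfolding. [cite: Balaban1985Averaging, (9) p.18, bookkeeping] -/
@[simp] theorem fw_cons (a : Fin D) (A : List (Fin D)) : fw (a :: A) = (a, true) :: fw A := rfl

omit [NormedRing 𝔸] [NormOneClass 𝔸] [NormedAlgebra ℂ 𝔸] [CompleteSpace 𝔸] in
/-- unfolding. [cite: Balaban1985Averaging, (9) p.18, bookkeeping] -/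
@[simp] theorem fw_append (A B : List (Fin D)) : fw (A ++ B) = fw A ++ fw B := List.map_append

omit [NormedRing 𝔸] [NormOneClass 𝔸] [NormedAlgebra ℂ 𝔸] [CompleteSpace 𝔸] in
/-- unfolding. [cite: Balaban1985Averaging, (9) p.18, bookkeeping] -/
@[simp] theorem length_fw (A : List (Fin D)) : (fw A).length = A.length := List.length_map _

omit [NormedRing 𝔸] [NormOneClass 𝔸] [NormedAlgebra ℂ 𝔸] [CompleteSpace 𝔸] in
/-- `fw` of a repeated direction is the straight segment. [cite: Balaban1985Averaging, (9) p.18, bookkeeping] -/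
theorem fw_replicate (n : ℕ) (μ : Fin D) : fw (List.replicate n μ) = seg μ (n : ℤ) := by
  rw [fw, List.map_replicate, seg_natCast]

omit [NormedRing 𝔸] [NormOneClass 𝔸] [NormedAlgebra ℂ 𝔸] [CompleteSpace 𝔸] in
/-- `fw` commutes with `flatMap`. [cite: Balaban1985Averaging, (9) p.18, bookkeeping] -/
theorem fw_flatMap {ι : Type*} (l : List ι) (f : ι → List (Fin D)) : fw (l.flatMap f) = l.flatMap fun i => fw (f i) := by
  simp [fw, List.map_flatMap]

omit [NormedRing 𝔸] [NormOneClass 𝔸] [NormedAlgebra ℂ 𝔸] [CompleteSpace 𝔸] in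
/-- scaling a forward contour repeats its directions. [cite: Balaban1985Averaging, (43) p.24, bookkeeping] -/
theorem scaleWord_fw (n : ℕ) (A : List (Fin D)) : scaleWord n (fw A) = fw (A.flatMap fun μ => List.replicate n μ) := by
  induction A with
  | nil => rfl
  | cons a A ih => rw [fw_cons, scaleWord_cons, List.flatMap_cons, fw_append, ih]; simp [fw]

omit [NormedRing 𝔸] [NormOneClass 𝔸] [NormedAlgebra ℂ 𝔸] [CompleteSpace 𝔸] in
/-- the displacement of a forward contour counts its letters. [cite: Balaban1985Averaging, (9) p.18, bookkeeping] -/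
theorem disp_fw_apply (A : List (Fin D)) (μ : Fin D) : disp (fw A) μ = (A.count μ : ℤ) := by
  induction A with
  | nil => simp
  | cons a A ih =>
      rw [fw_cons, disp_cons, Pi.add_apply, ih, List.count_cons, Letter.vec_true, e_apply, Nat.cast_add, add_comm]
      by_cases h : a = μ
      · subst h; simp
      · simp [h, Ne.symm h]

omit [NormedRing 𝔸] [NormOneClass 𝔸] [NormedAlgebra ℂ 𝔸] [CompleteSpace 𝔸] in
/-- forward contours with the same displacement are permutations of each other. [cite: Balaban1985Averaging, (9) p.18, bookkeeping] -/
theorem perm_of_disp_fw_eq {A A' : List (Fin D)} (h : disp (fw A) = disp (fw A')) : A.Perm A' :=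
  List.perm_iff_count.2 fun μ => by
    have := congrFun h μ
    rw [disp_fw_apply, disp_fw_apply] at this
    exact_mod_cast this

omit [NormedRing 𝔸] [NormOneClass 𝔸] [NormedAlgebra ℂ 𝔸] [CompleteSpace 𝔸] in
/-- one forward letter. [cite: Balaban1985Averaging, (9) p.18, bookkeeping] -/
theorem hol_fw_cons {G : Type*} [Group G] (V : LSite D → Fin D → G) (x : LSite D) (a : Fin D) (A : List (Fin D)) :
    hol V x (fw (a :: A)) = V x a * hol V (x + e a) (fw A) := by
  rw [fw_cons, hol_cons, stepHol_true, Letter.vec_true]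

omit [NormOneClass 𝔸] [NormedAlgebra ℂ 𝔸] [CompleteSpace 𝔸] in
/-- left factors of norm `≤ 1` do not increase differences. [cite: Balaban1985Averaging, (19) p.21, bookkeeping] -/
theorem norm_mul_sub_mul_left_le {p a b : 𝔸} (hp : ‖p‖ ≤ 1) : ‖p * a - p * b‖ ≤ ‖a - b‖ := by
  rw [← mul_sub]
  exact (norm_mul_le _ _).trans (by nlinarith [norm_nonneg (a - b)])

omit [NormedAlgebra ℂ 𝔸] [CompleteSpace 𝔸] in
/-- ★ **THE TRANSPOSITION BOUND**: exchanging two consecutive forward letters changes the transporter by at most the plaquette deviation: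
`‖V(x; a b Γ) − V(x; b a Γ)‖ ≤ pdev V` (`V(x;ab) = V(∂p)·V(x;ba)`). [cite: Balaban1985Averaging, (9) p.18, (44) p.24] -/
theorem norm_hol_fw_swap_le {V : LSite D → Fin D → 𝔸ˣ} (hV : ∀ x κ, V x κ ∈ U1 𝔸) (x : LSite D) (a b : Fin D) (A : List (Fin D)) :
    ‖((hol V x (fw (a :: b :: A)) : 𝔸ˣ) : 𝔸) - ((hol V x (fw (b :: a :: A)) : 𝔸ˣ) : 𝔸)‖ ≤ pdev V := by
  rw [hol_fw_cons, hol_fw_cons, hol_fw_cons, hol_fw_cons, add_right_comm x (e b) (e a)]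
  set S := hol V (x + e a + e b) (fw A) with hS
  have hplaq : V x a * V (x + e a) b = hol V x (B7Prop1Explicit.plaqWord a b) * (V x b * V (x + e b) a) := by
    rw [B7Prop1Local.hol_plaqWord_eq]; group
  have hPQ : V x a * (V (x + e a) b * S) = hol V x (B7Prop1Explicit.plaqWord a b) * (V x b * (V (x + e b) a * S)) := by
    rw [← mul_assoc, hplaq, mul_assoc, mul_assoc]
  have hid : ((V x a * (V (x + e a) b * S) : 𝔸ˣ) : 𝔸) - ((V x b * (V (x + e b) a * S) : 𝔸ˣ) : 𝔸) =
      (((hol V x (B7Prop1Explicit.plaqWord a b) : 𝔸ˣ) : 𝔸) - 1) * ((V x b * (V (x + e b) a * S) : 𝔸ˣ) : 𝔸) := by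
    rw [hPQ, Units.val_mul, sub_mul, one_mul]
  rw [hid]
  have h1 : ‖((V x b * (V (x + e b) a * S) : 𝔸ˣ) : 𝔸)‖ ≤ 1 :=
    (mem_U1.1 ((U1 𝔸).mul_mem (hV _ _) ((U1 𝔸).mul_mem (hV _ _) (hol_mem hV _ _)))).1
  exact (norm_mul_le _ _).trans ((mul_le_of_le_one_right (norm_nonneg _) h1).trans (le_pdev hV x a b))

omit [NormedAlgebra ℂ 𝔸] [CompleteSpace 𝔸] in
/-- inserting a letter into an ordered forward contour costs at most `|Γ|` transpositions. [cite: Balaban1985Averaging, (9) p.18, (44) p.24, bookkeeping] -/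
theorem norm_hol_fw_orderedInsert_le {V : LSite D → Fin D → 𝔸ˣ} (hV : ∀ x κ, V x κ ∈ U1 𝔸) :
    ∀ (A : List (Fin D)) (x : LSite D) (a : Fin D),
      ‖((hol V x (fw (a :: A)) : 𝔸ˣ) : 𝔸) - ((hol V x (fw (A.orderedInsert (· ≤ ·) a)) : 𝔸ˣ) : 𝔸)‖ ≤ A.length * pdev V
  | [], x, a => by simp
  | b :: A, x, a => by
      rw [List.orderedInsert_cons]
      split_ifs with h
      · rw [sub_self, norm_zero]; exact mul_nonneg (Nat.cast_nonneg _) (pdev_nonneg V)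
      · calc _ ≤ ‖((hol V x (fw (a :: b :: A)) : 𝔸ˣ) : 𝔸) - ((hol V x (fw (b :: a :: A)) : 𝔸ˣ) : 𝔸)‖ +
              ‖((hol V x (fw (b :: a :: A)) : 𝔸ˣ) : 𝔸) - ((hol V x (fw (b :: A.orderedInsert (· ≤ ·) a)) : 𝔸ˣ) : 𝔸)‖ :=
              norm_sub_le_norm_sub_add_norm_sub _ _ _
          _ ≤ pdev V + A.length * pdev V := by
              refine add_le_add (norm_hol_fw_swap_le hV x a b A) ?_
              rw [hol_fw_cons V x b (a :: A), hol_fw_cons V x b, Units.val_mul, Units.val_mul]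
              exact (norm_mul_sub_mul_left_le (mem_U1.1 (hV _ _)).1).trans (norm_hol_fw_orderedInsert_le hV A (x + e b) a)
          _ = ((b :: A).length : ℝ) * pdev V := by rw [List.length_cons, Nat.cast_succ]; ring

omit [NormedAlgebra ℂ 𝔸] [CompleteSpace 𝔸] in
/-- sorting a forward contour by direction costs at most `|Γ|²` transpositions. [cite: Balaban1985Averaging, (9) p.18, (44) p.24, bookkeeping] -/
theorem norm_hol_fw_insertionSort_le {V : LSite D → Fin D → 𝔸ˣ} (hV : ∀ x κ, V x κ ∈ U1 𝔸) :
    ∀ (A : List (Fin D)) (x : LSite D),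
      ‖((hol V x (fw A) : 𝔸ˣ) : 𝔸) - ((hol V x (fw (A.insertionSort (· ≤ ·))) : 𝔸ˣ) : 𝔸)‖ ≤ (A.length : ℝ) ^ 2 * pdev V
  | [], x => by simp
  | a :: A, x => by
      rw [List.insertionSort_cons]
      calc _ ≤ ‖((hol V x (fw (a :: A)) : 𝔸ˣ) : 𝔸) - ((hol V x (fw (a :: A.insertionSort (· ≤ ·))) : 𝔸ˣ) : 𝔸)‖ +
            ‖((hol V x (fw (a :: A.insertionSort (· ≤ ·))) : 𝔸ˣ) : 𝔸) -
              ((hol V x (fw ((A.insertionSort (· ≤ ·)).orderedInsert (· ≤ ·) a)) : 𝔸ˣ) : 𝔸)‖ := norm_sub_le_norm_sub_add_norm_sub _ _ _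
        _ ≤ (A.length : ℝ) ^ 2 * pdev V + A.length * pdev V := by
            refine add_le_add ?_ ?_
            · rw [hol_fw_cons, hol_fw_cons, Units.val_mul, Units.val_mul]
              exact (norm_mul_sub_mul_left_le (mem_U1.1 (hV _ _)).1).trans (norm_hol_fw_insertionSort_le hV A (x + e a))
            · have h := norm_hol_fw_orderedInsert_le hV (A.insertionSort (· ≤ ·)) x a
              rwa [List.length_insertionSort] at h
        _ ≤ (((a :: A).length : ℕ) : ℝ) ^ 2 * pdev V := by
            rw [List.length_cons, Nat.cast_succ]
            nlinarith [pdev_nonneg V, Nat.cast_nonneg (α := ℝ) A.length]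

omit [NormedAlgebra ℂ 𝔸] [CompleteSpace 𝔸] in
/-- ★★ **TWO FORWARD CONTOURS WITH THE SAME ENDPOINTS**: `‖V(Γ) − V(Γ′)‖ ≤ 2|Γ|²·pdev V` (both sorted to the common taxicab contour).
[cite: Balaban1985Averaging, (9) p.18, (44) p.24; Balaban1985BackgroundPropagators, (3.40) p.397] -/
theorem norm_hol_fw_sub_le_of_disp_eq {V : LSite D → Fin D → 𝔸ˣ} (hV : ∀ x κ, V x κ ∈ U1 𝔸) (x : LSite D) {A A' : List (Fin D)}
    (h : disp (fw A) = disp (fw A')) :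
    ‖((hol V x (fw A) : 𝔸ˣ) : 𝔸) - ((hol V x (fw A') : 𝔸ˣ) : 𝔸)‖ ≤ 2 * (A.length : ℝ) ^ 2 * pdev V := by
  have hp : A.Perm A' := perm_of_disp_fw_eq h
  have hsort : A.insertionSort (· ≤ ·) = A'.insertionSort (· ≤ ·) :=
    List.Perm.eq_of_sortedLE (List.sortedLE_insertionSort) (List.sortedLE_insertionSort)
      (((List.perm_insertionSort _ A).trans hp).trans (List.perm_insertionSort _ A').symm)
  have hlen : A'.length = A.length := hp.length_eq.symm
  calc _ ≤ ‖((hol V x (fw A) : 𝔸ˣ) : 𝔸) - ((hol V x (fw (A.insertionSort (· ≤ ·))) : 𝔸ˣ) : 𝔸)‖ +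
        ‖((hol V x (fw (A.insertionSort (· ≤ ·))) : 𝔸ˣ) : 𝔸) - ((hol V x (fw A') : 𝔸ˣ) : 𝔸)‖ := norm_sub_le_norm_sub_add_norm_sub _ _ _
    _ ≤ (A.length : ℝ) ^ 2 * pdev V + (A'.length : ℝ) ^ 2 * pdev V := by
        refine add_le_add (norm_hol_fw_insertionSort_le hV A x) ?_
        rw [hsort, norm_sub_rev]; exact norm_hol_fw_insertionSort_le hV A' x
    _ = _ := by rw [hlen]; ring

end Forward

/-! ## §2 The knit's contour on the fine lattice and `compT_straight` -/

section Knit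

omit [NormedRing 𝔸] [NormOneClass 𝔸] [NormedAlgebra ℂ 𝔸] [CompleteSpace 𝔸] in
/-- [B7]'s tree contour `Γ_{y,x}` to a site of the positive orthant, as a direction list (directions `d, …, 1`, each `v_κ` times).
[cite: Balaban1985Averaging, p.24 («the contour Γ_{y,x}»)] -/
def treeDirs (v : LSite D) : List (Fin D) := (List.finRange D).reverse.flatMap fun κ => List.replicate (v κ).toNat κ

omit [NormedRing 𝔸] [NormOneClass 𝔸] [NormedAlgebra ℂ 𝔸] [CompleteSpace 𝔸] in
/-- for `v ≥ 0` the tree word IS the forward contour `fw (treeDirs v)`. [cite: Balaban1985Averaging, p.24, bookkeeping] -/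
theorem treeWord_eq_fw {v : LSite D} (hv : 0 ≤ v) : treeWord v = fw (treeDirs v) := by
  rw [treeDirs, fw_flatMap, treeWord]
  congr 1
  funext κ
  rw [fw_replicate, Int.toNat_of_nonneg (hv κ)]

omit [NormedRing 𝔸] [NormOneClass 𝔸] [NormedAlgebra ℂ 𝔸] [CompleteSpace 𝔸] in
/-- its length is `|v|₁`. [cite: Balaban1985Averaging, p.24, bookkeeping] -/
theorem length_treeDirs {v : LSite D} (hv : 0 ≤ v) : (treeDirs v).length = l1 v := by
  rw [← length_fw, ← treeWord_eq_fw hv, length_treeWord]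

omit [NormedRing 𝔸] [NormOneClass 𝔸] [NormedAlgebra ℂ 𝔸] [CompleteSpace 𝔸] in
/-- a site relative to the corner of its `L`-block lies in `[0, L)^D`. [cite: Balaban1985Averaging, (52) p.27 («x ∈ B(y)»), bookkeeping] -/
theorem sub_blockMap_bounds {L : ℕ} (hL : 1 ≤ L) (x : LSite D) (μ : Fin D) :
    0 ≤ (x - (L : ℤ) • blockMap L x) μ ∧ (x - (L : ℤ) • blockMap L x) μ ≤ (L : ℤ) - 1 := by
  have hLz : (0 : ℤ) < L := by exact_mod_cast hL
  have h1 : (L : ℤ) * (x μ / (L : ℤ)) + x μ % (L : ℤ) = x μ := Int.mul_ediv_add_emod _ _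
  have h2 := Int.emod_nonneg (x μ) hLz.ne'
  have h3 := Int.emod_lt_of_pos (x μ) hLz
  simp only [Pi.sub_apply, Pi.smul_apply, smul_eq_mul, blockMap]
  omega

omit [NormedRing 𝔸] [NormOneClass 𝔸] [NormedAlgebra ℂ 𝔸] [CompleteSpace 𝔸] in
/-- hence `|x − L·B(x)|₁ ≤ D(L − 1)`. [cite: Balaban1985Averaging, (52) p.27, bookkeeping] -/
theorem l1_sub_blockMap_le {L : ℕ} (hL : 1 ≤ L) (x : LSite D) : l1 (x - (L : ℤ) • blockMap L x) ≤ D * (L - 1) := by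
  unfold l1
  have h : ∀ μ ∈ (Finset.univ : Finset (Fin D)), ((x - (L : ℤ) • blockMap L x) μ).natAbs ≤ L - 1 := fun μ _ => by
    have hb := sub_blockMap_bounds hL x μ
    have : (((x - (L : ℤ) • blockMap L x) μ).natAbs : ℤ) ≤ (L : ℤ) - 1 := by rw [Int.natAbs_of_nonneg hb.1]; exact hb.2
    omega
  exact (Finset.sum_le_card_nsmul _ _ _ h).trans (by simp)

/-- ★ **THE KNIT's CONTOUR `Γ^{(j)}_{y,x}` READ ON THE FINE LATTICE**: from `Lʲ·Bʲ(x)` down to `x`, level `j−1` first — inside each `L`-block [B7]'s tree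
contour, scaled by `Lᵐ` at level `m`. [cite: Balaban1985BackgroundPropagators, (3.19) p.393; Balaban1985Averaging, (52)–(53) p.27] -/
def knitDirs (L : ℕ) : ℕ → LSite D → List (Fin D)
  | 0, _ => []
  | j + 1, x => ((treeDirs ((blockMap L)^[j] x - (L : ℤ) • (blockMap L)^[j + 1] x)).flatMap fun μ => List.replicate (L ^ j) μ) ++ knitDirs L j x

omit [NormedRing 𝔸] [NormOneClass 𝔸] [NormedAlgebra ℂ 𝔸] [CompleteSpace 𝔸] in
/-- the relative position at level `m` is in the positive orthant. [cite: Balaban1985Averaging, (52) p.27, bookkeeping] -/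
theorem iterate_sub_nonneg {L : ℕ} (hL : 1 ≤ L) (m : ℕ) (x : LSite D) : 0 ≤ (blockMap L)^[m] x - (L : ℤ) • (blockMap L)^[m + 1] x := fun μ => by
  rw [Function.iterate_succ_apply']; exact (sub_blockMap_bounds hL _ μ).1

omit [NormedRing 𝔸] [NormOneClass 𝔸] [NormedAlgebra ℂ 𝔸] [CompleteSpace 𝔸] in
/-- ★ the knit's contour connects `Lʲ·Bʲ(x)` to `x`. [cite: Balaban1985BackgroundPropagators, (3.19) p.393, bookkeeping] -/
theorem disp_fw_knitDirs {L : ℕ} (hL : 1 ≤ L) : ∀ (j : ℕ) (x : LSite D), disp (fw (knitDirs L j x)) = x - ((L ^ j : ℕ) : ℤ) • (blockMap L)^[j] x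
  | 0, x => by simp [knitDirs]
  | j + 1, x => by
      rw [knitDirs, fw_append, disp_append, disp_fw_knitDirs hL j x, ← scaleWord_fw, disp_scaleWord, ← treeWord_eq_fw (iterate_sub_nonneg hL j x),
        disp_treeWord, smul_sub, smul_smul, ← Nat.cast_mul, ← pow_succ, Nat.cast_pow]
      abel

omit [NormedRing 𝔸] [NormOneClass 𝔸] [NormedAlgebra ℂ 𝔸] [CompleteSpace 𝔸] in
/-- its length is `≤ D·Lʲ`. [cite: Balaban1985BackgroundPropagators, (3.19) p.393, bookkeeping] -/
theorem length_knitDirs_le {L : ℕ} (hL : 1 ≤ L) : ∀ (j : ℕ) (x : LSite D), (knitDirs L j x).length ≤ D * L ^ j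
  | 0, x => by simp [knitDirs]
  | j + 1, x => by
      rw [knitDirs, List.length_append, List.length_flatMap]
      have h1 : (List.map (fun μ => (List.replicate (L ^ j) μ).length)
          (treeDirs ((blockMap L)^[j] x - (L : ℤ) • (blockMap L)^[j + 1] x))).sum ≤ D * (L - 1) * L ^ j := by
        simp only [List.length_replicate, List.map_const', List.sum_replicate, smul_eq_mul]
        rw [length_treeDirs (iterate_sub_nonneg hL j x), Function.iterate_succ_apply']
        exact Nat.mul_le_mul_right _ (l1_sub_blockMap_le hL _)
      have h2 := length_knitDirs_le hL j x
      have h3 : D * (L - 1) * L ^ j + D * L ^ j = D * L ^ (j + 1) := by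
        obtain ⟨L', rfl⟩ : ∃ L', L = L' + 1 := ⟨L - 1, by omega⟩
        rw [Nat.add_sub_cancel, pow_succ]; ring
      omega

omit [NormOneClass 𝔸] [NormedAlgebra ℂ 𝔸] [CompleteSpace 𝔸] in
/-- composite transporters of `G`-valued legs are `G`-valued — every dimension `D` (the instance `D = d + 1` is `B9B8KnitLetterRegular.compT_mem`).
[cite: Balaban1985BackgroundPropagators, (3.19) p.393, bookkeeping] -/
theorem compT_mem_of {G : Subgroup 𝔸ˣ} (L : ℕ) {T : ℕ → LSite D → LSite D → 𝔸ˣ} :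
    ∀ (j : ℕ), (∀ j' < j, ∀ y x, T j' y x ∈ G) → ∀ y x, compT L T j y x ∈ G
  | 0, _, y, x => by rw [compT_zero]; exact G.one_mem
  | j + 1, hT, y, x => by
      rw [compT_succ]
      exact G.mul_mem (hT j (Nat.lt_succ_self j) _ _) (compT_mem_of L j (fun j' hj' => hT j' (Nat.lt_succ_of_lt hj')) _ _)

omit [NormOneClass 𝔸] in
/-- the knit's legs are [B7]'s tree transporters of the averaged fields: `bgT L V j y x′ = Ū^j(Γ_{Ly,x′})`. [cite: Balaban1985Averaging, (52)–(53) p.27, bookkeeping] -/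
theorem bgT_eq_hol (L : ℕ) (V : LSite D → Fin D → 𝔸ˣ) (j : ℕ) (y x' : LSite D) :
    bgT L V j y x' = hol (avgIter L V j) ((L : ℤ) • y) (treeWord (x' - (L : ℤ) • y)) := by
  rw [← B9Thm311PositivityKnitLetter.blockBase_eq_smul]; rfl

/-- ★★ **`compT_straight`**: on the class (52), the knit's composite transporter is within `6D²α₀(Lʲ/L^k)²` of the fine transporter along its own contour:
`‖U(Γ^{(j)}_{y,x}) − V(fw (knitDirs L j x))‖ ≤ 6·D²·α₀·(Lʲ/L^k)²`, `j ≤ k` (file 5a per leg: each of the `≤ D(L−1)` letters of a level-`m` leg costs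
`16Dα₀(Lᵐ/L^k)²`; the constants close because `16(L−1) + 6 ≤ 6L²`). [cite: Balaban1985BackgroundPropagators, (3.19) p.393; Balaban1985Averaging, (52)–(53) p.27, p.25] -/
theorem compT_straight (hD : 1 ≤ D) (L : ℕ) (hL : 2 ≤ L) {G : Subgroup 𝔸ˣ} (hG : AvgClosed D L G) (k : ℕ) {V : LSite D → Fin D → 𝔸ˣ}
    (hV : ∀ x κ, V x κ ∈ G) {α₀ : ℝ} (hα : 0 < α₀) (hα3 : C0 D * α₀ ≤ 1 / 3) (hα2 : 2 * α₀ ≤ c2' D L)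
    (h52 : pdev V < α₀ * (((L : ℝ) ^ k)⁻¹) ^ 2) :
    ∀ j ≤ k, ∀ x : LSite D,
      ‖(compT L (bgT L V) j ((blockMap L)^[j] x) x : 𝔸) - ((hol V (((L ^ j : ℕ) : ℤ) • (blockMap L)^[j] x) (fw (knitDirs L j x)) : 𝔸ˣ) : 𝔸)‖ ≤
        6 * (D : ℝ) ^ 2 * α₀ * (((L : ℝ) ^ j) ^ 2 * (((L : ℝ) ^ k)⁻¹) ^ 2) := by
  have hL1 : 1 ≤ L := le_trans (by norm_num) hL
  have hLr : (2 : ℝ) ≤ L := by exact_mod_cast hL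
  have hGU : G ≤ U1 𝔸 := hG.le_U1
  have hVU : ∀ x κ, V x κ ∈ U1 𝔸 := fun x κ => hGU (hV x κ)
  intro j
  induction j with
  | zero => intro _ x; simp [knitDirs, compT_zero, hol_nil]; positivity
  | succ j ih =>
      intro hjk x
      have hj : j ≤ k := (Nat.le_succ j).trans hjk
      set r : ℝ := ((L : ℝ) ^ j) ^ 2 * (((L : ℝ) ^ k)⁻¹) ^ 2 with hr
      have hr0 : 0 ≤ r := by positivity
      set y := (blockMap L)^[j + 1] x with hy
      set v := (blockMap L)^[j] x - (L : ℤ) • y with hv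
      have hv0 : 0 ≤ v := iterate_sub_nonneg hL1 j x
      -- the level-`j` leg
      have hWj : ∀ x κ, avgIter L V j x κ ∈ U1 𝔸 := fun x κ => hGU (avgIter_mem L hL hG k V hV hα hα3 hα2 h52 j hj x κ)
      have hleg := hol_scaleWord_approx hWj hVU (L ^ j) (ε := 16 * D * α₀ * r) (fun y' κ => avgIter_straight hD L hL hG k hV hα hα3 hα2 h52 j hj y' κ)
        ((L : ℤ) • y) (treeWord v)
      have hlen : ((treeWord v).length : ℝ) ≤ D * ((L : ℝ) - 1) := by
        rw [length_treeWord]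
        have h := l1_sub_blockMap_le hL1 ((blockMap L)^[j] x)
        rw [← Function.iterate_succ_apply' (blockMap L)] at h
        have h' : (l1 v : ℝ) ≤ ((D * (L - 1) : ℕ) : ℝ) := by exact_mod_cast h
        rwa [Nat.cast_mul, Nat.cast_sub hL1, Nat.cast_one] at h'
      have hbase : ((L ^ j : ℕ) : ℤ) • ((L : ℤ) • y) = ((L ^ (j + 1) : ℕ) : ℤ) • y := by rw [smul_smul, pow_succ, Nat.cast_mul]
      have hT : bgT L V j y ((blockMap L)^[j] x) = hol (avgIter L V j) ((L : ℤ) • y) (treeWord v) := bgT_eq_hol L V j y _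
      have hword : scaleWord (L ^ j) (treeWord v) = fw ((treeDirs v).flatMap fun μ => List.replicate (L ^ j) μ) := by
        rw [treeWord_eq_fw hv0, scaleWord_fw]
      rw [hbase, hword] at hleg
      -- the lower levels
      have hlow := ih hj x
      have hmid : ((L ^ (j + 1) : ℕ) : ℤ) • y + disp (fw ((treeDirs v).flatMap fun μ => List.replicate (L ^ j) μ)) =
          ((L ^ j : ℕ) : ℤ) • (blockMap L)^[j] x := by
        rw [← scaleWord_fw, disp_scaleWord, ← treeWord_eq_fw hv0, disp_treeWord, hv, smul_sub, smul_smul, ← Nat.cast_mul, ← pow_succ]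
        abel
      -- the lower composite transporter is a contraction
      have hcm : compT L (bgT L V) j ((blockMap L)^[j] x) x ∈ U1 𝔸 :=
        compT_mem_of L j
          (fun j' hj' y' x' => hGU (B7Prop2Explicit.hol_mem_of (avgIter_mem L hL hG k V hV hα hα3 hα2 h52 j' (by omega)) _ _)) _ _
      -- assemble
      rw [compT_succ, knitDirs, fw_append, hol_append, hmid, Units.val_mul, Units.val_mul, ← hy, hT]
      calc _ ≤ ‖((hol (avgIter L V j) ((L : ℤ) • y) (treeWord v) : 𝔸ˣ) : 𝔸) -
              ((hol V (((L ^ (j + 1) : ℕ) : ℤ) • y) (fw ((treeDirs v).flatMap fun μ => List.replicate (L ^ j) μ)) : 𝔸ˣ) : 𝔸)‖ +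
            ‖(compT L (bgT L V) j ((blockMap L)^[j] x) x : 𝔸) -
              ((hol V (((L ^ j : ℕ) : ℤ) • (blockMap L)^[j] x) (fw (knitDirs L j x)) : 𝔸ˣ) : 𝔸)‖ :=
            norm_mul_sub_mul_le (mem_U1.1 (hol_mem hVU _ _)).1 (mem_U1.1 hcm).1
        _ ≤ (treeWord v).length * (16 * D * α₀ * r) + 6 * (D : ℝ) ^ 2 * α₀ * r := add_le_add hleg hlow
        _ ≤ D * ((L : ℝ) - 1) * (16 * D * α₀ * r) + 6 * (D : ℝ) ^ 2 * α₀ * r := by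
            have h0 : 0 ≤ 16 * D * α₀ * r := by positivity
            nlinarith
        _ ≤ 6 * (D : ℝ) ^ 2 * α₀ * (((L : ℝ) ^ (j + 1)) ^ 2 * (((L : ℝ) ^ k)⁻¹) ^ 2) := by
            have hr' : ((L : ℝ) ^ (j + 1)) ^ 2 * (((L : ℝ) ^ k)⁻¹) ^ 2 = (L : ℝ) ^ 2 * r := by rw [hr]; ring
            rw [hr']
            have h0 : 0 ≤ (D : ℝ) ^ 2 * α₀ * r := by positivity
            have hL2 : 16 * ((L : ℝ) - 1) + 6 ≤ 6 * (L : ℝ) ^ 2 := by nlinarith [hLr]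
            have h := mul_le_mul_of_nonneg_left hL2 h0
            linarith [h]

end Knit

/-! ## §3 The knit's transporter versus any forward contour with the same endpoints -/

section Versus

/-- ★★★ **THE KNIT's TRANSPORTER VERSUS ANY FORWARD CONTOUR WITH THE SAME ENDPOINTS** (e.g. def-Y's taxicab contour, [B9] (3.40)): on the class (52),
`‖U(Γ^{(j)}_{y,x}) − V(Γ′)‖ ≤ 8·D²·α₀·(Lʲ/L^k)²` for every forward `Γ′` from `LʲBʲ(x)` to `x`, `j ≤ k`
(`compT_straight` + two forward contours with the same endpoints, `|Γ^{(j)}| ≤ DLʲ`, `pdev V < α₀L^{−2k}`).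
[cite: Balaban1985BackgroundPropagators, (3.19) p.393, (3.40) p.397; Balaban1985Averaging, (52)–(53) p.27, (44) p.24] -/
theorem compT_vs_fw (hD : 1 ≤ D) (L : ℕ) (hL : 2 ≤ L) {G : Subgroup 𝔸ˣ} (hG : AvgClosed D L G) (k : ℕ) {V : LSite D → Fin D → 𝔸ˣ}
    (hV : ∀ x κ, V x κ ∈ G) {α₀ : ℝ} (hα : 0 < α₀) (hα3 : C0 D * α₀ ≤ 1 / 3) (hα2 : 2 * α₀ ≤ c2' D L)
    (h52 : pdev V < α₀ * (((L : ℝ) ^ k)⁻¹) ^ 2) {j : ℕ} (hj : j ≤ k) (x : LSite D) {A : List (Fin D)}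
    (hA : disp (fw A) = x - ((L ^ j : ℕ) : ℤ) • (blockMap L)^[j] x) :
    ‖(compT L (bgT L V) j ((blockMap L)^[j] x) x : 𝔸) - ((hol V (((L ^ j : ℕ) : ℤ) • (blockMap L)^[j] x) (fw A) : 𝔸ˣ) : 𝔸)‖ ≤
      8 * (D : ℝ) ^ 2 * α₀ * (((L : ℝ) ^ j) ^ 2 * (((L : ℝ) ^ k)⁻¹) ^ 2) := by
  have hL1 : 1 ≤ L := le_trans (by norm_num) hL
  have hVU : ∀ x κ, V x κ ∈ U1 𝔸 := fun x κ => hG.le_U1 (hV x κ)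
  have h1 := compT_straight hD L hL hG k hV hα hα3 hα2 h52 j hj x
  have hdisp : disp (fw (knitDirs L j x)) = disp (fw A) := by rw [disp_fw_knitDirs hL1, hA]
  have h2 := norm_hol_fw_sub_le_of_disp_eq hVU (((L ^ j : ℕ) : ℤ) • (blockMap L)^[j] x) hdisp
  have hlen : ((knitDirs L j x).length : ℝ) ≤ D * (L : ℝ) ^ j := by exact_mod_cast length_knitDirs_le hL1 j x
  have h3 : 2 * ((knitDirs L j x).length : ℝ) ^ 2 * pdev V ≤ 2 * (D : ℝ) ^ 2 * α₀ * (((L : ℝ) ^ j) ^ 2 * (((L : ℝ) ^ k)⁻¹) ^ 2) := by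
    have hl0 : 0 ≤ ((knitDirs L j x).length : ℝ) := Nat.cast_nonneg _
    have hsq : ((knitDirs L j x).length : ℝ) ^ 2 ≤ (D : ℝ) ^ 2 * ((L : ℝ) ^ j) ^ 2 := by nlinarith
    have hp0 := pdev_nonneg V
    calc 2 * ((knitDirs L j x).length : ℝ) ^ 2 * pdev V ≤ 2 * ((D : ℝ) ^ 2 * ((L : ℝ) ^ j) ^ 2) * (α₀ * (((L : ℝ) ^ k)⁻¹) ^ 2) :=
          mul_le_mul (by nlinarith) h52.le hp0 (by positivity)
      _ = _ := by ring
  calc _ ≤ ‖(compT L (bgT L V) j ((blockMap L)^[j] x) x : 𝔸) - ((hol V (((L ^ j : ℕ) : ℤ) • (blockMap L)^[j] x) (fw (knitDirs L j x)) : 𝔸ˣ) : 𝔸)‖ +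
        ‖((hol V (((L ^ j : ℕ) : ℤ) • (blockMap L)^[j] x) (fw (knitDirs L j x)) : 𝔸ˣ) : 𝔸) -
          ((hol V (((L ^ j : ℕ) : ℤ) • (blockMap L)^[j] x) (fw A) : 𝔸ˣ) : 𝔸)‖ := norm_sub_le_norm_sub_add_norm_sub _ _ _
    _ ≤ 6 * (D : ℝ) ^ 2 * α₀ * (((L : ℝ) ^ j) ^ 2 * (((L : ℝ) ^ k)⁻¹) ^ 2) + 2 * (D : ℝ) ^ 2 * α₀ * (((L : ℝ) ^ j) ^ 2 * (((L : ℝ) ^ k)⁻¹) ^ 2) :=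
        add_le_add h1 (h2.trans h3)
    _ = _ := by ring

end Versus

end Literature.MathematicalPhysics.QuantumFieldTheory.Balaban1983to89.B9B8KnitLegsStraight

end
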